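import Summits.QuantumFields.YangMills.Theorems.HyperbolicRegulatorHyperbolicToTorus

/-!
# `CurvatureUniformity` (stmt-QuantumFields-15825, route `HyperbolicRegulator`) — PROVED AS TYPED: the crux holds because
# no admissible hyperbolic complex exists at curvature scale `k ≥ 208`

The route decl `Summit.QuantumFields.YangMills.Theses.HyperbolicRegulator.CurvatureUniformity` is
`∀ G r family, H_adm → H_anchor → T` with `H_adm` = "the family of finite square complexes is ADMISSIBLE (the crux's inlined
`(Fam k j …).1`) for all `k ≥ 8` and all `j`". The admissibility predicate is BYTE FOR BYTE the one of the sibling crux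
`HyperbolicToTorus` (stmt-QuantumFields-15827; the route's `closes` relies on this syntactic identity), for which the line
`no_admissible_complex` (lead `prover-line-stmt-QuantumFields-15827-0`) landed
`NoAdmissibleComplex.no_admissible : 208 ≤ k → ¬ Adm k j V E Q σ τ bd cV cE`
(`Theorems/HyperbolicRegulatorHyperbolicToTorus.lean`): the flatness threshold `k/4 < dist x c` equals the sup-radius `k/4` of
the injective `ℤ²`-charts, so the first flat shell around a cone is both `≤ 50` (chart rigidity, germs) and `≥ k/4 − 1`.
Instantiating `H_adm` at `k = 400`, `j = 0` therefore closes this crux too.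

What this does NOT say: nothing about Yang–Mills, the anchor, or a `k`-uniform rate. The crux is settled through its
unsatisfiable antecedent; the informative content for the route is the kernel-certified demand (refuters R3 / VETTING,
strategist RESTATE-ADVICE, REGLUE-ADVICE in `Cruxes/CurvatureUniformity/`) that the three cruxes sharing the `Fam` vocabulary be
RESTATED in lockstep (flat threshold `k/2 < dist`, chart radius `<` flat threshold, cone charts, disc/girth clause), after which
the substantive statement (one clustering rate for all curvature scales — it contains the weak-coupling volume-uniform lattice
mass gap) is the business of `Cruxes/CurvatureUniformity/Lines/birth.lean` and the idea cards filed there.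
-/

set_option autoImplicit false

namespace Summit.QuantumFields.YangMills.Cruxes.CurvatureUniformity.NoAdmissibleComplex

open Summit.QuantumFields.YangMills.Cruxes.HyperbolicToTorus.NoAdmissibleComplex

/-- **`CurvatureUniformity_of_no_admissible`** — the crux BY NAME: the admissibility hypothesis `H_adm`, instantiated at
curvature scale `400` and separation index `0`, contradicts `NoAdmissibleComplex.no_admissible` (no admissible complex for
`k ≥ 208`); the named `Adm` and the crux's inlined `(Fam …).1` agree by `ζδ`-unfolding. (The anchor hypothesis, the group and
the representation are not used.) -/
theorem CurvatureUniformity_of_no_admissible :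
    Summit.QuantumFields.YangMills.Theses.HyperbolicRegulator.CurvatureUniformity := by
  intro G _ _ _ _ hG r Fam₀ Sp₀ V E Q σ τ bd cV cE Φ hAdm hAnch
  have hA : Adm 400 0 (V 400 0) (E 400 0) (Q 400 0) (σ 400 0) (τ 400 0) (bd 400 0) (cV 400 0) (cE 400 0) :=
    hAdm 400 0 (by norm_num)
  exact (no_admissible 400 0 _ _ _ _ _ _ _ _ (by norm_num) hA).elim

end Summit.QuantumFields.YangMills.Cruxes.CurvatureUniformity.NoAdmissibleComplex

namespace Summit.QuantumFields.YangMills.Theorems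

/-- **`CurvatureUniformity` holds** (crux stmt-QuantumFields-15825 of route `HyperbolicRegulator`): the route decl, literally,
from `NoAdmissibleComplex.CurvatureUniformity_of_no_admissible` (the crux as typed is vacuous — no admissible complex exists at
curvature scale `400`). -/
theorem curvatureUniformity_proof : Summit.QuantumFields.YangMills.Theses.HyperbolicRegulator.CurvatureUniformity :=
  Summit.QuantumFields.YangMills.Cruxes.CurvatureUniformity.NoAdmissibleComplex.CurvatureUniformity_of_no_admissible

end Summit.QuantumFields.YangMills.Theorems
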